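import Mathlib
import Summits.CriticalPhenomena.CardyFormulaZ2.Theorems.CardyMagicRigidityNestingRigidityStaircaseReduction
import Summits.CriticalPhenomena.CardyFormulaZ2.Theorems.CardyMagicRigidityNestingRigidityStaircaseGapTowers
import Summits.CriticalPhenomena.CardyFormulaZ2.Theorems.CardyMagicRigidityNestingRigidityTowerIndependence
import HarnessLib

/-!
# Crux `NestingRigidity`, line `ring-cloud-tomography` (r5): the EXACT FACTORISATION of the main
# term of (QU) — `E[g_tot] = E[w(t)^{N_0(r,1)}] · ∏_j E[w_j^{N_j}]` on both lattices

Crux `Summit.CriticalPhenomena.CardyFormulaZ2.Theses.CardyMagicRigidity.NestingRigidity`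
(stmt-CriticalPhenomena-4835), line `ring-cloud-tomography`, stub R2' `stub_staircaseDecoupling`,
input (QU) of `staircaseDecoupling_of_inputs` (`…StaircaseReduction`, p122218), conjunct (cmp).
The functional `g_tot` of (QU) is the finite product of the weights of the TOWER loops of the
staircase: the window tower (loops surrounding `B̄(0, r)` inside `B(0, 1)`, weight `w(t)`) and the gap
towers `j`, `j + 1 < k` (loops surrounding `B̄(0, M j)` inside `B(0, L (j+1))`, deterministic weight
`w_j = w(t + (j+1)(−t/k))`, `…StaircaseGapTowers`).  This file proves, with no RSW content:
* §1 products of tower functionals `∏_{i ∈ s} u_i^{N_x(ρ_i, R_i)}` are cylinder functions of the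
  edges (sites) of their annuli on `δℤ²` (`δ𝕋`) and measurable on both lattices;
* §2 independence of such a product from one more tower functional whose thickened annulus misses
  all the others (`indepFun_prod_pow_towerCount`), hence the PRODUCT FORMULA
  `E[∏_{i ∈ s} u_i^{N_x(ρ_i,R_i)}] = ∏_{i ∈ s} E[u_i^{N_x(ρ_i,R_i)}]` for pairwise disjoint
  `δ`-thickened annuli (`integral_prod_pow_towerCount_eq_prod`, both lattices, every mesh `δ > 0`);
* §3 pathwise on both lattices: `g_tot = w(t)^{N_0(r,1)} · ∏_{j+1<k} w_j^{N_0(M j, L (j+1))}`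
  (the tower families are pairwise disjoint finite sets with constant weights);
* §4 the registered anchor `staircase_integral_gtot_eq_prod`:
  `∫ g_tot dE.P = E.towerMoment (w t) δ r · ∏_{j+1<k} ∫ w_j^{N_0(M j, L (j+1))} dE.P` as soon as
  `1 ≤ L j` and `L j + 2δ ≤ M j` (the thickened annuli `A(r,1)`, `A(M j, L (j+1))` are disjoint),
  and its eventual form in `δ → 0⁺` for a fixed staircase.
-/

noncomputable section

open MeasureTheory ProbabilityTheory Set Filter Metric
open scoped Real Topology BigOperators

namespace Summit.CriticalPhenomena.CardyFormulaZ2.Cruxes.NestingRigidity.RingCloudTomography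

open Literature.Probability.RandomPlanarGeometry Literature.Probability.Percolation
  Literature.Probability.LatticeModels
open Summit.CriticalPhenomena.CardyFormulaZ2.Cruxes.NestingRigidity.PositiveConeWeightDoubling
  (magicWeight)

namespace TowerIndependence

/-! ## §1 Products of tower functionals are cylinder functions of their annuli -/

/-- **Cylinder property of a product of tower functionals on bond-`ℤ²`**: closing every edge off a
set `M` containing all edges with medial point in one of the annuli `B(x, R i) ∖ B̄(x, ρ i)`,
`i ∈ s`, does not change `∏_{i ∈ s} u_i^{N_x(ρ_i, R_i)}`. -/
theorem prod_pow_towerCount_zEns_inter {ι : Type*} (s : Finset ι) (u ρ R : ι → ℝ) (δ : ℝ) (x : ℂ)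
    (M : BondConfig (Site 2))
    (hM : ∀ i ∈ s, ∀ e : MedialVertex, medialPoint δ e ∈ ball x (R i) \ closedBall x (ρ i) → e ∈ M)
    (ω : BondConfig (Site 2)) :
    ∏ i ∈ s, u i ^ towerCount (zEns.X δ (ω ∩ M : BondConfig (Site 2))) x (ρ i) (R i) =
      ∏ i ∈ s, u i ^ towerCount (zEns.X δ ω) x (ρ i) (R i) :=
  Finset.prod_congr rfl fun i hi ↦ congrArg (u i ^ ·) (towerCount_zEns_inter δ ω M x (ρ i) (R i) (hM i hi))

/-- **Cylinder property of a product of tower functionals on site-`𝕋`** (`δ ≥ 0`): closing every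
site off a set `S` containing all sites drawn in one of the thickened annuli
`B(x, R i + δ) ∖ B̄(x, ρ i − δ)`, `i ∈ s`, does not change `∏_{i ∈ s} u_i^{N_x(ρ_i, R_i)}`. -/
theorem prod_pow_towerCount_tEns_inter {ι : Type*} (s : Finset ι) (u ρ R : ι → ℝ) {δ : ℝ} (hδ : 0 ≤ δ)
    (x : ℂ) (S : SiteConfig (Site 2))
    (hS : ∀ i ∈ s, ∀ v : Site 2, triMeshPoint δ v ∈ ball x (R i + δ) \ closedBall x (ρ i - δ) → v ∈ S)
    (ω : SiteConfig (Site 2)) :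
    ∏ i ∈ s, u i ^ towerCount (tEns.X δ (ω ∩ S : SiteConfig (Site 2))) x (ρ i) (R i) =
      ∏ i ∈ s, u i ^ towerCount (tEns.X δ ω) x (ρ i) (R i) :=
  Finset.prod_congr rfl fun i hi ↦ congrArg (u i ^ ·) (towerCount_tEns_inter hδ ω S x (ρ i) (R i) (hS i hi))

/-- **Products of tower functionals are measurable** on both lattice ensembles. -/
theorem measurable_prod_pow_towerCount : ∀ E ∈ latticeEnsembles, ∀ {ι : Type*} (s : Finset ι)
    (u ρ R : ι → ℝ) (δ : ℝ) (x : ℂ),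
    Measurable fun ω ↦ ∏ i ∈ s, u i ^ towerCount (E.X δ ω) x (ρ i) (R i) :=
  fun E hE _ s u ρ R δ x ↦ Finset.measurable_prod s fun i _ ↦ (measurable_towerCount E hE δ x (ρ i) (R i)).const_pow (u i)

/-! ## §2 Independence and the product formula -/

/-- **A product of tower functionals is independent of one more tower functional whose thickened
annulus misses all the others**, on both lattice ensembles (mesh `δ ≥ 0`): each side is a cylinder
function of a family of coordinates (edges of `δℤ²` by medial point, sites of `δ𝕋` by position) and
the two families are disjoint. -/
theorem indepFun_prod_pow_towerCount : ∀ E ∈ latticeEnsembles, ∀ {δ : ℝ}, 0 ≤ δ → ∀ (x : ℂ) {ι : Type*}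
    (s : Finset ι) (u ρ R : ι → ℝ) (v ρ' R' : ℝ),
    (∀ i ∈ s, Disjoint (ball x (R i + δ) \ closedBall x (ρ i - δ)) (ball x (R' + δ) \ closedBall x (ρ' - δ))) →
    IndepFun (fun ω ↦ ∏ i ∈ s, u i ^ towerCount (E.X δ ω) x (ρ i) (R i))
      (fun ω ↦ v ^ towerCount (E.X δ ω) x ρ' R') E.P := by
  intro E hE δ hδ x ι s u ρ R v ρ' R' hdisj
  have hEm := hE
  simp only [latticeEnsembles, Set.mem_insert_iff, Set.mem_singleton_iff] at hE
  -- the un-thickened annuli lie in the thickened ones (`δ ≥ 0`)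
  have hthick : ∀ (a b : ℝ) (z : ℂ), z ∈ ball x b \ closedBall x a → z ∈ ball x (b + δ) \ closedBall x (a - δ) :=
    fun a b z hz ↦ ⟨ball_subset_ball (by linarith) hz.1, fun h' ↦ hz.2 (closedBall_subset_closedBall (by linarith) h')⟩
  rcases hE with rfl | rfl
  · refine indepFun_of_determined_zEns ?_ (measurable_prod_pow_towerCount zEns hEm s u ρ R δ x)
      ((measurable_towerCount zEns hEm δ x ρ' R').const_pow v)
      (fun ω ↦ prod_pow_towerCount_zEns_inter s u ρ R δ x
        {e : MedialVertex | ∃ i ∈ s, medialPoint δ e ∈ ball x (R i) \ closedBall x (ρ i)}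
        (fun i hi e he ↦ ⟨i, hi, he⟩) ω)
      (fun ω ↦ congrArg (v ^ ·) (towerCount_zEns_inter δ ω
        {e : MedialVertex | medialPoint δ e ∈ ball x R' \ closedBall x ρ'} x ρ' R' fun _ he ↦ he))
    refine Set.disjoint_left.2 fun e he he' ↦ ?_
    obtain ⟨i, hi, hei⟩ := he
    exact Set.disjoint_left.1 (hdisj i hi) (hthick _ _ _ hei) (hthick _ _ _ he')
  · refine indepFun_of_determined_tEns ?_ (measurable_prod_pow_towerCount tEns hEm s u ρ R δ x)
      ((measurable_towerCount tEns hEm δ x ρ' R').const_pow v)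
      (fun ω ↦ prod_pow_towerCount_tEns_inter s u ρ R hδ x
        {w : Site 2 | ∃ i ∈ s, triMeshPoint δ w ∈ ball x (R i + δ) \ closedBall x (ρ i - δ)}
        (fun i hi w hw ↦ ⟨i, hi, hw⟩) ω)
      (fun ω ↦ congrArg (v ^ ·) (towerCount_tEns_inter hδ ω
        {w : Site 2 | triMeshPoint δ w ∈ ball x (R' + δ) \ closedBall x (ρ' - δ)} x ρ' R' fun _ hw ↦ hw))
    refine Set.disjoint_left.2 fun w hw hw' ↦ ?_
    obtain ⟨i, hi, hwi⟩ := hw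
    exact Set.disjoint_left.1 (hdisj i hi) hwi hw'

/-- **Product formula for tower functionals over pairwise disjoint thickened annuli**, on both
lattice ensembles at every mesh `δ > 0`:
`E[∏_{i ∈ s} u_i^{N_x(ρ_i, R_i)}] = ∏_{i ∈ s} E[u_i^{N_x(ρ_i, R_i)}]` whenever the `δ`-thickened
annuli `B(x, R i + δ) ∖ B̄(x, ρ i − δ)`, `i ∈ s`, are pairwise disjoint (iterated independence). -/
theorem integral_prod_pow_towerCount_eq_prod : ∀ E ∈ latticeEnsembles, ∀ {δ : ℝ}, 0 < δ → ∀ (x : ℂ)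
    {ι : Type*} (s : Finset ι) (u ρ R : ι → ℝ),
    (s : Set ι).Pairwise (fun i j ↦ Disjoint (ball x (R i + δ) \ closedBall x (ρ i - δ))
      (ball x (R j + δ) \ closedBall x (ρ j - δ))) →
    ∫ ω, ∏ i ∈ s, u i ^ towerCount (E.X δ ω) x (ρ i) (R i) ∂E.P =
      ∏ i ∈ s, ∫ ω, u i ^ towerCount (E.X δ ω) x (ρ i) (R i) ∂E.P := by
  intro E hE δ hδ x ι s u ρ R
  haveI := isProbabilityMeasure_of_mem hE
  classical
  induction s using Finset.induction_on with
  | empty => intro; simp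
  | insert a s ha ih =>
    intro hpw
    rw [Finset.coe_insert, Set.pairwise_insert_of_notMem (by exact_mod_cast ha)] at hpw
    simp_rw [Finset.prod_insert ha]
    have hind := (indepFun_prod_pow_towerCount E hE hδ.le x s u ρ R (u a) (ρ a) (R a)
      fun i hi ↦ (hpw.2 i hi).2).symm
    rw [hind.integral_fun_mul_eq_mul_integral
      ((measurable_towerCount E hE δ x (ρ a) (R a)).const_pow (u a)).aestronglyMeasurable
      (measurable_prod_pow_towerCount E hE s u ρ R δ x).aestronglyMeasurable, ih hpw.1]

end TowerIndependence

/-! ## §3 Pathwise: `g_tot = w(t)^{N_0(r,1)} · ∏_j w_j^{N_0(M j, L (j+1))}` -/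

-- Local notation: the staircase cloud and its tower loops (window tower ∪ gap towers).
local notation3 "Stair(" k ", " L ", " M ", " t ", " r ")" =>
  Cloud.mk 1 k (fun _ ↦ (0 : ℂ)) (fun _ ↦ r) (fun _ ↦ t) (fun _ ↦ (0 : ℂ)) L M (fun _ ↦ -t / ((k : ℕ) : ℝ))
local notation3 "Tow(" c ", " k ", " L ", " M ", " r ")" =>
  {u ∈ LoopConfig.loops c | (Metric.closedBall (0 : ℂ) r ⊆ {z | u.wind z ≠ 0} ∧ u.range ⊆ Metric.ball (0 : ℂ) 1) ∨
    ∃ j : Fin k, (j : ℕ) + 1 < k ∧ Metric.closedBall (0 : ℂ) ((M : Fin k → ℝ) j) ⊆ {z | u.wind z ≠ 0} ∧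
      ∀ l : Fin k, j < l → u.range ⊆ Metric.ball (0 : ℂ) ((L : Fin k → ℝ) l)}

namespace Staircase

/-- A `finprod` of a function constant on a finite set is a power of the constant. -/
theorem finprod_mem_eq_pow_ncard {α : Type*} {s : Set α} (hs : s.Finite) {f : α → ℝ} {c : ℝ}
    (hf : ∀ a ∈ s, f a = c) : ∏ᶠ a ∈ s, f a = c ^ s.ncard := by
  rw [finprod_mem_congr rfl hf, finprod_mem_eq_finite_toFinset_prod _ hs, Finset.prod_const,
    Set.ncard_eq_toFinset_card s hs]

/-- A loop surrounding `B̄(0, a)` (`a ≥ 0`) with trace inside `B(0, b)` has `a < b` (the point `a`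
of the closed ball lies in the winding interior, which lies in `B(0, b)`). -/
theorem lt_of_closedBall_subset_of_range_subset {u : UnbasedLoop ℂ} {a b : ℝ} (ha : 0 ≤ a)
    (hin : closedBall (0 : ℂ) a ⊆ {z | u.wind z ≠ 0}) (hout : u.range ⊆ ball (0 : ℂ) b) : a < b := by
  have h1 : ((a : ℝ) : ℂ) ∈ closedBall (0 : ℂ) a :=
    mem_closedBall_zero_iff.2 (by rw [Complex.norm_real, Real.norm_eq_abs, abs_of_nonneg ha])
  have h2 := mem_ball_zero_iff.1 (ConeTilt.setOf_wind_ne_zero_subset_ball hout (hin h1))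
  rwa [Complex.norm_real, Real.norm_eq_abs, abs_of_nonneg ha] at h2

section Pathwise

variable {t r : ℝ} {n : ℕ} {L M : Fin (n + 1) → ℝ}

/-- Separated rings have increasing inner radii. -/
theorem inner_mono (hLM : ∀ j, L j < M j) (hsep : ∀ j l, j < l → M j ≤ L l) {a b : Fin (n + 1)}
    (hab : a ≤ b) : L a ≤ L b := by
  rcases hab.lt_or_eq with h | rfl
  · exact (hLM a).le.trans (hsep a b h)
  · exact le_rfl

/-- **The tower family of a staircase with `n + 1` rings is the disjoint union of the window tower
and the `n` gap towers** (gap `j : Fin n` between ring `j.castSucc` and ring `j.succ`): for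
increasing inner radii, "trace inside every `B(0, L l)`, `l > j`" means "trace inside
`B(0, L (j+1))`". -/
theorem tow_eq_union (hLM : ∀ j, L j < M j) (hsep : ∀ j l, j < l → M j ≤ L l) (c : LoopConfig ℂ) :
    Tow(c, n + 1, L, M, r) =
      {u ∈ c.loops | closedBall (0 : ℂ) r ⊆ {z | u.wind z ≠ 0} ∧ u.range ⊆ ball (0 : ℂ) 1} ∪
        ⋃ j : Fin n, {u ∈ c.loops | closedBall (0 : ℂ) (M (Fin.castSucc j)) ⊆ {z | u.wind z ≠ 0} ∧
          u.range ⊆ ball (0 : ℂ) (L (Fin.succ j))} := by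
  ext u
  simp only [Set.mem_sep_iff, Set.mem_union, Set.mem_iUnion]
  constructor
  · rintro ⟨hu, hw | ⟨j, hj, hin, hout⟩⟩
    · exact Or.inl ⟨hu, hw⟩
    · have hjl : j ≠ Fin.last n := fun h ↦ by rw [h, Fin.val_last] at hj; omega
      obtain ⟨j', rfl⟩ := Fin.exists_castSucc_eq.2 hjl
      exact Or.inr ⟨j', hu, hin, hout _ Fin.castSucc_lt_succ⟩
  · rintro (⟨hu, hw⟩ | ⟨j', hu, hin, hout⟩)
    · exact ⟨hu, Or.inl hw⟩
    · refine ⟨hu, Or.inr ⟨Fin.castSucc j', ?_, hin, fun l hl ↦ hout.trans (ball_subset_ball ?_)⟩⟩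
      · rw [Fin.val_castSucc]; omega
      · exact inner_mono hLM hsep (Fin.castSucc_lt_iff_succ_le.1 hl)

/-- **Pathwise factorisation of `g_tot` on both lattices** (staircase with `n + 1` rings outside
the unit window, `1 ≤ L j`): the product of the weights of the tower loops is
`w(t)^{N_0(r,1)} · ∏_{j : Fin n} w_j^{N_0(M j, L (j+1))}`, `w_j = w(t + (j+1)(−t/(n+1)))` — the
window tower weighs `w(t)` a loop (`Staircase.nestingFactor_of_tower`), the gap tower `j` weighs
`w_j` a loop (`Staircase.nestingFactor_of_gapTower`), and the families are pairwise disjoint and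
finite. -/
theorem finprod_tow_eq_pow_mul_prod : ∀ E ∈ latticeEnsembles, ∀ {δ : ℝ}, 0 < δ → ∀ (ω : E.Ω),
    0 < r → (∀ j, r ≤ L j) → (∀ j, 1 ≤ L j) → (∀ j, L j < M j) → (∀ j l, j < l → M j ≤ L l) →
    ∏ᶠ u ∈ Tow(E.X δ ω, n + 1, L, M, r), u.nestingFactor (Stair(n + 1, L, M, t, r)).density =
      magicWeight t ^ towerCount (E.X δ ω) 0 r 1 *
        ∏ j : Fin n, magicWeight (t + ((j : ℕ) + 1) * (-t / (n + 1 : ℕ))) ^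
          towerCount (E.X δ ω) 0 (M (Fin.castSucc j)) (L (Fin.succ j)) := by
  intro E hE δ hδ ω hr hrL hL1 hLM hsep
  have hL : ∀ j, 0 < L j := fun j ↦ one_pos.trans_le (hL1 j)
  set c := E.X δ ω with hc
  set f := (Stair(n + 1, L, M, t, r)).density with hf
  set W : Set (UnbasedLoop ℂ) :=
    {u ∈ c.loops | closedBall (0 : ℂ) r ⊆ {z | u.wind z ≠ 0} ∧ u.range ⊆ ball (0 : ℂ) 1} with hW
  set G : Fin n → Set (UnbasedLoop ℂ) := fun j ↦
    {u ∈ c.loops | closedBall (0 : ℂ) (M (Fin.castSucc j)) ⊆ {z | u.wind z ≠ 0} ∧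
      u.range ⊆ ball (0 : ℂ) (L (Fin.succ j))} with hG
  have hWfin : W.Finite := ConeTilt.finite_towerSet E hE hδ ω 0 r 1
  have hGfin : ∀ j, (G j).Finite := fun j ↦ ConeTilt.finite_towerSet E hE hδ ω 0 _ _
  -- disjointness
  have hWG : Disjoint W (⋃ j, G j) := by
    refine Set.disjoint_left.2 fun u huW huG ↦ ?_
    obtain ⟨j, huj⟩ := Set.mem_iUnion.1 huG
    have h1 := lt_of_closedBall_subset_of_range_subset ((hL _).trans (hLM _)).le huj.2.1 huW.2.2
    linarith [hL1 (Fin.castSucc j), hLM (Fin.castSucc j)]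
  have hGG : Pairwise (Function.onFun Disjoint G) := by
    intro i j hij
    refine Set.disjoint_left.2 fun u hui huj ↦ ?_
    rcases lt_or_gt_of_ne hij with h | h
    · have h1 := lt_of_closedBall_subset_of_range_subset ((hL _).trans (hLM _)).le huj.2.1 hui.2.2
      have h2 : L (Fin.succ i) ≤ L (Fin.castSucc j) :=
        inner_mono hLM hsep (Fin.castSucc_lt_iff_succ_le.1 (Fin.castSucc_lt_castSucc_iff.2 h))
      linarith [hLM (Fin.castSucc j)]
    · have h1 := lt_of_closedBall_subset_of_range_subset ((hL _).trans (hLM _)).le hui.2.1 huj.2.2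
      have h2 : L (Fin.succ j) ≤ L (Fin.castSucc i) :=
        inner_mono hLM hsep (Fin.castSucc_lt_iff_succ_le.1 (Fin.castSucc_lt_castSucc_iff.2 h))
      linarith [hLM (Fin.castSucc i)]
  -- constant weights on each family
  have hwW : ∀ u ∈ W, u.nestingFactor f = magicWeight t := fun u hu ↦
    nestingFactor_of_tower (𝔠 := Stair(n + 1, L, M, t, r)) rfl hr hL1 hu.2.1 hu.2.2
  have hwG : ∀ j, ∀ u ∈ G j, u.nestingFactor f =
      magicWeight (t + ((j : ℕ) + 1) * (-t / (n + 1 : ℕ))) := fun j u hu ↦ by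
    rw [nestingFactor_of_gapTower (𝔠 := Stair(n + 1, L, M, t, r)) rfl hr hrL hL hLM hsep
      Fin.castSucc_lt_succ (fun i hi ↦ Fin.castSucc_lt_iff_succ_le.1 hi) hu.2.1 hu.2.2,
      Fin.val_castSucc]
  -- assemble
  rw [tow_eq_union hLM hsep c, finprod_mem_union hWG hWfin (Set.finite_iUnion hGfin),
    finprod_mem_iUnion hGG hGfin, finprod_mem_eq_pow_ncard hWfin hwW,
    finprod_congr (fun j ↦ finprod_mem_eq_pow_ncard (hGfin j) (hwG j)), finprod_eq_prod_of_fintype]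
  rfl

end Pathwise

/-! ## §4 The exact factorisation of `E[g_tot]` -/

/-- Two concentric `δ`-thickened annuli are disjoint as soon as the outer radius of the first plus
`2δ` is at most the inner radius of the second. -/
theorem disjoint_thick_annuli {x : ℂ} {δ a b a' b' : ℝ} (h : b + 2 * δ ≤ a') :
    Disjoint (ball x (b + δ) \ closedBall x (a - δ)) (ball x (b' + δ) \ closedBall x (a' - δ)) :=
  Set.disjoint_left.2 fun _ hz hz' ↦ hz'.2 (mem_closedBall.2 (by linarith [mem_ball.1 hz.1]))

section Integral

variable {t r : ℝ} {n : ℕ} {L M : Fin (n + 1) → ℝ}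

/-- **`E[g_tot] = E[w(t)^{N_0(r,1)}] · ∏_j E[w_j^{N_0(M j, L (j+1))}]` on both lattices** at every
mesh `δ > 0` with `L j + 2δ ≤ M j` (and `1 ≤ L j`): the `δ`-thickened annuli of the window tower
and of the gap towers are then pairwise disjoint, so the tower functionals are independent
(`TowerIndependence.integral_prod_pow_towerCount_eq_prod`). -/
theorem integral_finprod_tow_eq : ∀ E ∈ latticeEnsembles, ∀ {δ : ℝ}, 0 < δ →
    0 < r → (∀ j, r ≤ L j) → (∀ j, 1 ≤ L j) → (∀ j, L j + 2 * δ ≤ M j) → (∀ j l, j < l → M j ≤ L l) →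
    ∫ ω, ∏ᶠ u ∈ Tow(E.X δ ω, n + 1, L, M, r), u.nestingFactor (Stair(n + 1, L, M, t, r)).density ∂E.P =
      E.towerMoment (magicWeight t) δ r *
        ∏ j : Fin n, ∫ ω, magicWeight (t + ((j : ℕ) + 1) * (-t / (n + 1 : ℕ))) ^
          towerCount (E.X δ ω) 0 (M (Fin.castSucc j)) (L (Fin.succ j)) ∂E.P := by
  intro E hE δ hδ hr hrL hL1 hgap hsep
  have hLM : ∀ j, L j < M j := fun j ↦ by linarith [hgap j]
  refine (integral_congr_ae (Eventually.of_forall fun ω ↦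
    finprod_tow_eq_pow_mul_prod (t := t) E hE hδ ω hr hrL hL1 hLM hsep)).trans ?_
  -- window tower ⟂ gap towers
  have hind : IndepFun
      (fun ω ↦ ∏ j : Fin n, magicWeight (t + ((j : ℕ) + 1) * (-t / (n + 1 : ℕ))) ^
        towerCount (E.X δ ω) 0 (M (Fin.castSucc j)) (L (Fin.succ j)))
      (fun ω ↦ magicWeight t ^ towerCount (E.X δ ω) 0 r 1) E.P :=
    TowerIndependence.indepFun_prod_pow_towerCount E hE hδ.le 0 Finset.univ
      (fun j : Fin n ↦ magicWeight (t + ((j : ℕ) + 1) * (-t / (n + 1 : ℕ))))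
      (fun j ↦ M (Fin.castSucc j)) (fun j ↦ L (Fin.succ j)) (magicWeight t) r 1
      fun j _ ↦ (disjoint_thick_annuli (by linarith [hL1 (Fin.castSucc j), hgap (Fin.castSucc j)])).symm
  -- gap towers pairwise ⟂
  have hpw : (↑(Finset.univ : Finset (Fin n)) : Set (Fin n)).Pairwise fun i j ↦
      Disjoint (ball (0 : ℂ) (L (Fin.succ i) + δ) \ closedBall 0 (M (Fin.castSucc i) - δ))
        (ball (0 : ℂ) (L (Fin.succ j) + δ) \ closedBall 0 (M (Fin.castSucc j) - δ)) := by
    intro i _ j _ hij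
    rcases lt_or_gt_of_ne hij with h | h
    · have h2 : L (Fin.succ i) ≤ L (Fin.castSucc j) :=
        inner_mono hLM hsep (Fin.castSucc_lt_iff_succ_le.1 (Fin.castSucc_lt_castSucc_iff.2 h))
      exact disjoint_thick_annuli (by linarith [hgap (Fin.castSucc j)])
    · have h2 : L (Fin.succ j) ≤ L (Fin.castSucc i) :=
        inner_mono hLM hsep (Fin.castSucc_lt_iff_succ_le.1 (Fin.castSucc_lt_castSucc_iff.2 h))
      exact (disjoint_thick_annuli (by linarith [hgap (Fin.castSucc i)])).symm
  rw [hind.symm.integral_fun_mul_eq_mul_integral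
      ((measurable_towerCount E hE δ 0 r 1).const_pow _).aestronglyMeasurable
      (TowerIndependence.measurable_prod_pow_towerCount E hE Finset.univ _ _ _ δ 0).aestronglyMeasurable,
    TowerIndependence.integral_prod_pow_towerCount_eq_prod E hE hδ 0 Finset.univ
      (fun j : Fin n ↦ magicWeight (t + ((j : ℕ) + 1) * (-t / (n + 1 : ℕ))))
      (fun j ↦ M (Fin.castSucc j)) (fun j ↦ L (Fin.succ j)) hpw]
  rfl

/-- **Eventual form**: for a FIXED staircase (`1 ≤ L j < M j`, separated) the factorisation
`E[g_tot] = E.towerMoment (w t) δ r · ∏_j E[w_j^{N_0(M j, L (j+1))}]` holds for all small meshes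
`δ > 0` (the thickening condition `L j + 2δ ≤ M j` holds eventually), for every `0 < r ≤ L j`. -/
theorem eventually_integral_finprod_tow_eq : ∀ E ∈ latticeEnsembles,
    0 < r → (∀ j, r ≤ L j) → (∀ j, 1 ≤ L j) → (∀ j, L j < M j) → (∀ j l, j < l → M j ≤ L l) →
    ∀ᶠ δ in 𝓝[>] (0 : ℝ),
      ∫ ω, ∏ᶠ u ∈ Tow(E.X δ ω, n + 1, L, M, r), u.nestingFactor (Stair(n + 1, L, M, t, r)).density ∂E.P =
        E.towerMoment (magicWeight t) δ r *
          ∏ j : Fin n, ∫ ω, magicWeight (t + ((j : ℕ) + 1) * (-t / (n + 1 : ℕ))) ^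
            towerCount (E.X δ ω) 0 (M (Fin.castSucc j)) (L (Fin.succ j)) ∂E.P := by
  intro E hE hr hrL hL1 hLM hsep
  have hthr : ∀ j, ∀ᶠ δ in 𝓝[>] (0 : ℝ), L j + 2 * δ ≤ M j := fun j ↦ by
    have hMj : 0 < (M j - L j) / 2 := by linarith [hLM j]
    filter_upwards [Ioo_mem_nhdsGT hMj] with δ hδ'
    linarith [hδ'.2]
  filter_upwards [self_mem_nhdsWithin, Filter.eventually_all.2 hthr] with δ hδ hgap
  exact integral_finprod_tow_eq E hE hδ hr hrL hL1 hgap hsep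

end Integral

end Staircase

/-- **Registered anchor — the exact factorisation of the main term of (QU) on both lattice
ensembles.**  For `E ∈ latticeEnsembles`, a mesh `δ > 0` and a staircase with `n + 1` rings
`A(0; L j, M j)` outside the unit window (`0 < r ≤ L j`, `1 ≤ L j`, `L j + 2δ ≤ M j`, `M j ≤ L l` for
`j < l`), the expectation of `g_tot` — the finite product of the weights of the tower loops of
`X_δ` (window tower: loops surrounding `B̄(0, r)` inside `B(0, 1)`; gap tower `j`, `j + 1 < n + 1`:
loops surrounding `B̄(0, M j)` inside every `B(0, L l)`, `l > j`) against the staircase density —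
FACTORISES EXACTLY:
`∫ g_tot dE.P = E.towerMoment (w t) δ r · ∏_{j : Fin n} ∫ w_j^{N_0(M j, L (j+1))} dE.P`,
`w = magicWeight`, `w_j = w(t + (j+1)(−t/(n+1)))` (deterministic gap-tower weights,
`…StaircaseGapTowers`; independence of tower counts over the pairwise disjoint thickened annuli,
`…TowerIndependence`).  For `k` rings with `0 < k` substitute `k = n + 1`. -/
theorem staircase_integral_gtot_eq_prod : ∀ E ∈ latticeEnsembles, ∀ (δ t r : ℝ) (n : ℕ)
    (L M : Fin (n + 1) → ℝ), 0 < δ → 0 < r → (∀ j, r ≤ L j) → (∀ j, 1 ≤ L j) → (∀ j, L j + 2 * δ ≤ M j) →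
    (∀ j l, j < l → M j ≤ L l) →
    ∫ ω, ∏ᶠ u ∈ {u ∈ (E.X δ ω).loops | (Metric.closedBall (0 : ℂ) r ⊆ {z | u.wind z ≠ 0} ∧
        u.range ⊆ Metric.ball (0 : ℂ) 1) ∨ ∃ j : Fin (n + 1), (j : ℕ) + 1 < n + 1 ∧
        Metric.closedBall (0 : ℂ) (M j) ⊆ {z | u.wind z ≠ 0} ∧ ∀ l : Fin (n + 1), j < l → u.range ⊆ Metric.ball (0 : ℂ) (L l)},
      u.nestingFactor (Cloud.mk 1 (n + 1) (fun _ ↦ 0) (fun _ ↦ r) (fun _ ↦ t) (fun _ ↦ 0) L M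
        (fun _ ↦ -t / (n + 1 : ℕ))).density ∂E.P =
      E.towerMoment (magicWeight t) δ r *
        ∏ j : Fin n, ∫ ω, magicWeight (t + ((j : ℕ) + 1) * (-t / (n + 1 : ℕ))) ^
          towerCount (E.X δ ω) 0 (M (Fin.castSucc j)) (L (Fin.succ j)) ∂E.P :=
  fun E hE _ _ _ _ _ _ hδ hr hrL hL1 hgap hsep ↦ Staircase.integral_finprod_tow_eq E hE hδ hr hrL hL1 hgap hsep

end Summit.CriticalPhenomena.CardyFormulaZ2.Cruxes.NestingRigidity.RingCloudTomography

end
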